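import Summits.ResolutionOfSingularities.ResolutionOfSingularities.Theorems.PurelyInseparableDim4SwapTransportWindowResidualPrime
import Summits.ResolutionOfSingularities.ResolutionOfSingularities.Theorems.PurelyInseparableDim4ResConeCInfEntryOfChainPrime
import Summits.ResolutionOfSingularities.ResolutionOfSingularities.Theorems.PurelyInseparableDim4ResConeLightPairDichotomy
import Summits.ResolutionOfSingularities.ResolutionOfSingularities.Theorems.PurelyInseparableDim4FreeTailLemma
import HarnessLib
import HarnessLib.Audit.Tags

/-!
# Purely inseparable four-folds — THE LIGHT PAIR OF TAIL(p, p−1, 3) FOR EVERY PRIME, MODULO Q-FLAG (corner form)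
# (cell `res-dim4-pi`, K2(p) lane, rung-1 POWER-CONE LINE «light pair of TAIL(p, p−1, 3) ∀ p»: the conditional assembly of
# res-dim4-typ-1 g5's virtual window half, res-dim4-p-9's C∞ game via res-dim4-p-3 g5's finite game half, and res-dim4-p-3
# g5's entry; the `p = 5` instance is the UNCONDITIONAL `ResCone.cInf_no_chain`, `…ResConeCInfEntryOfChain` p702852)

[OURS · counted 0 · cell `res-dim4-pi` · K2(p) lane (holder res-dim4-p-12 g5, rulings g5-2 (6) / g5-6; the assembly name
`no_light_pair_powerCone_tail` is the holder's — this file is the CONDITIONAL form offered by the entry owner); seat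
res-dim4-p-3 g5.]  Nothing here proves K2(p) for any `p`, any TAIL(p, p−1, 3) outright, any TAIL(7, d, e), `NoIsolatedTrap p p`,
the Cossart–Jannsen–Saito theorem or resolution of singularities in dimension ≥ 4 / characteristic `p` — NOT proved.  AI
kernel work, weaker than expert review.  **CONDITIONAL on Q-FLAG (corner form)**, an OPEN hypothesis with hand evidence against
its universal form at `d ≥ 6` (bus 2026-08-29 10:47Z / 11:14Z); where it fails this theorem is VACUOUS.

**`cInf_no_chain_prime_of_cornerFlag`** (`d + 1 = p`, `2 ≤ d`): no witnessed isolated above-floor `Step0 p` chain with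
`x^{r₀} ∣ F₀` has, from some index on, shade `≡ d`, a POWER residual cone (`e_G ≡ 3`), LIGHT boundary weights (`≤ 1` of total
`2`) and both slots stretch-born — GIVEN Q-FLAG (corner form) `hQ` (spelled inline, see `cInf_hE_of_chain_prime_of_cornerFlag`):
res-dim4-typ-1 g5's `SwapTransport.cInf_no_chain_of_entry_prime` fed with ENTRY-5b.
**`cInf_no_chain_prime_of_chainFlag`**, **`no_light_pair_powerCone_tail_prime_of_chainFlag`**: the same two statements
from the PER-CHAIN form `hQc` (res-dim4-crit-4 g7, SR-4-g7-08): only the framed pure-corner children produced by ENTRY-5a ON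
THIS CHAIN, at all large precisions, are asked to carry a flagged row — strictly weaker than the universal `hQ`.
**`no_light_pair_powerCone_tail_prime_of_cornerFlag`**: the same WITHOUT the slots-born binder — res-dim4-p-2 g4's
`light_pair_dichotomy (p)` splits a light pair into a FREE TAIL (res-dim4's free-tail theorem `noIsolatedFreeTailAt_self (p)`)
or slots stretch-born.
[cite: CossartJannsenSaito2020, Thm. 3.14, Lemma 13.2] [cite: Hauser2010, §§F–G]
bears_on: LADDER-RESOLUTION:D157-DOOR2 (res-dim4-pi · K2(p) · power cones · light pair ∀ p modulo Q-FLAG).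
Supports stmt-ResolutionOfSingularities-16155 (helper).
-/

set_option linter.dupNamespace false -- mandated namespace of this single-conjunct summit

noncomputable section

namespace Summit.ResolutionOfSingularities.ResolutionOfSingularities.Theorems.PIDim4

namespace ResCone

open MvPolynomial Finset FrameChange
open Literature.AlgebraicGeometry.Resolution
open Literature.AlgebraicGeometry.Resolution.CentreBlowup
open Literature.AlgebraicGeometry.Resolution.Hauser2010
open Literature.AlgebraicGeometry.Resolution.HauserPerlega2019

variable {K : Type} [Field K] [DecidableEq K]

/-- **THE C∞ CONFIGURATION IS IMPOSSIBLE FOR EVERY PRIME, MODULO Q-FLAG ON THIS CHAIN'S FRAMED CHILDREN** (`hQc`, the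
per-chain form of res-dim4-crit-4 g7's SR-4-g7-08; module docstring). [OURS · CONDITIONAL] [cite: CossartJannsenSaito2020, Thm. 3.14] -/
theorem cInf_no_chain_prime_of_chainFlag (p : ℕ) [hp : Fact p.Prime] [CharP K p] {d : ℕ} (hdp : d + 1 = p) (hd2 : 2 ≤ d)
    {c : ℕ → State K} {j : ℕ → Fin 4} {b : ℕ → Fin 4 → K}
    (hc : ∀ k, IsIsolated p (c k).F ∧ Step0 p (c k) (c (k + 1))) (hw : FreeTail.IsWitnessedChain p c j b)
    (hr0 : ∀ e ∈ (c 0).F.support, (c 0).r ≤ e) (hfloor : ∀ k, ordZero (c k).F ≠ (p : ℕ)) {k₀ : ℕ}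
    (hshade : ∀ k, k₀ ≤ k → (c k).shade = ((d : ℕ) : ℕ∞))
    (he3 : ∀ k, k₀ ≤ k → Module.finrank K (resVertex (c k)) = 3) {k₁ : ℕ} (hk₁ : k₀ ≤ k₁)
    (hwt : ∀ k, k₀ ≤ k → (∀ i, (c k).r i ≤ 1) ∧ (c k).r.degree = 2)
    (hborn : ∀ k, k₁ ≤ k → ∀ i, 1 ≤ (c k).r i →
      ∃ t, k₀ ≤ t ∧ t < k ∧ j t = i ∧ ∀ m, t < m → m < k → j m ≠ i ∧ b m i = 0)
    (hQc : ∀ k', k₁ ≤ k' → 1 ≤ k' → ∃ M₀ : ℕ, ∀ M, M₀ ≤ M →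
      ∀ (la mu u f κ : Fin 4) (π₀ : Equiv.Perm (Fin 4)) (A₁ S₂ : State K) (Φ : MvPolynomial (Fin 4) K)
        (θ' e' : Fin 4 → MvPolynomial (Fin 4) K) (U' E' : MvPolynomial (Fin 4) K) (a : K),
        la ≠ mu → la ≠ u → la ≠ f → mu ≠ u → mu ≠ f → u ≠ f → (κ = la ∨ κ = mu) →
        θ' (π₀ la) = X la * e' la → θ' (π₀ mu) = X mu * e' mu → constantCoeff (e' la) ≠ 0 → constantCoeff (e' mu) ≠ 0 →
        constantCoeff (θ' (π₀ u)) = 0 → constantCoeff (θ' (π₀ f)) = 0 →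
        coeff (Finsupp.single u 1) (θ' (π₀ u)) * coeff (Finsupp.single f 1) (θ' (π₀ f)) -
          coeff (Finsupp.single f 1) (θ' (π₀ u)) * coeff (Finsupp.single u 1) (θ' (π₀ f)) ≠ 0 →
        constantCoeff U' ≠ 0 → E' ∈ originIdeal K ^ M → A₁.F = deletePthPowers p (U' ^ p * aeval θ' (c (k' + 1)).F) + E' →
        S₂.r = Finsupp.single la 1 + Finsupp.single mu 1 → (∀ e ∈ S₂.F.support, S₂.r ≤ e) →
        ordZero S₂.F = ((d + 2 : ℕ) : ℕ∞) → a ≠ 0 → resForm S₂ = C a * X f ^ d →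
        (∀ e ∈ S₂.F.support, e f ≤ d - 1 → 2 ≤ e la ∧ 2 ≤ e mu) →
        f ∉ Φ.vars → constantCoeff Φ = 0 →
        (CentreBlowup.step p Finset.univ κ 0 S₂).F = deletePthPowers p (tsch f Φ A₁.F) →
        ordZero (CentreBlowup.step p Finset.univ κ 0 S₂).F = ((d + 2 : ℕ) : ℕ∞) →
        IsIsolated p (CentreBlowup.step p Finset.univ κ 0 S₂).F →
        Module.finrank K (resVertex (CentreBlowup.step p Finset.univ κ 0 S₂)) = 3 →
        ∃ eu ef : ℕ, eu + ef = d - 2 ∧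
          coeff ((CentreBlowup.step p Finset.univ κ 0 S₂).r +
            (Finsupp.single la 1 + Finsupp.single mu 1 + Finsupp.single u (eu + 1) + Finsupp.single f ef))
            (CentreBlowup.step p Finset.univ κ 0 S₂).F ≠ 0) : False :=
  SwapTransport.cInf_no_chain_of_entry_prime p hdp hd2 hc hw hr0 hfloor hshade he3 hwt
    (cInf_hE_of_chain_prime_of_chainFlag p hdp hd2 hc hw hr0 hfloor hshade he3 hk₁ hwt hborn hQc)

/-- **NO LIGHT-PAIR POWER-CONE TAIL AT `(p, p − 1)`, MODULO Q-FLAG ON THIS CHAIN'S FRAMED CHILDREN** (`hQc` from `k₀`;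
module docstring). [OURS · CONDITIONAL] [cite: CossartJannsenSaito2020, Thm. 3.14] -/
theorem no_light_pair_powerCone_tail_prime_of_chainFlag (p : ℕ) [hp : Fact p.Prime] [CharP K p] {d : ℕ}
    (hdp : d + 1 = p) (hd2 : 2 ≤ d)
    {c : ℕ → State K} {j : ℕ → Fin 4} {b : ℕ → Fin 4 → K}
    (hc : ∀ k, IsIsolated p (c k).F ∧ Step0 p (c k) (c (k + 1))) (hw : FreeTail.IsWitnessedChain p c j b)
    (hr0 : ∀ e ∈ (c 0).F.support, (c 0).r ≤ e) (hfloor : ∀ k, ordZero (c k).F ≠ (p : ℕ)) {k₀ : ℕ}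
    (hshade : ∀ k, k₀ ≤ k → (c k).shade = ((d : ℕ) : ℕ∞))
    (he3 : ∀ k, k₀ ≤ k → Module.finrank K (resVertex (c k)) = 3)
    (hwt : ∀ k, k₀ ≤ k → (∀ i, (c k).r i ≤ 1) ∧ (c k).r.degree = 2)
    (hQc : ∀ k', k₀ ≤ k' → 1 ≤ k' → ∃ M₀ : ℕ, ∀ M, M₀ ≤ M →
      ∀ (la mu u f κ : Fin 4) (π₀ : Equiv.Perm (Fin 4)) (A₁ S₂ : State K) (Φ : MvPolynomial (Fin 4) K)
        (θ' e' : Fin 4 → MvPolynomial (Fin 4) K) (U' E' : MvPolynomial (Fin 4) K) (a : K),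
        la ≠ mu → la ≠ u → la ≠ f → mu ≠ u → mu ≠ f → u ≠ f → (κ = la ∨ κ = mu) →
        θ' (π₀ la) = X la * e' la → θ' (π₀ mu) = X mu * e' mu → constantCoeff (e' la) ≠ 0 → constantCoeff (e' mu) ≠ 0 →
        constantCoeff (θ' (π₀ u)) = 0 → constantCoeff (θ' (π₀ f)) = 0 →
        coeff (Finsupp.single u 1) (θ' (π₀ u)) * coeff (Finsupp.single f 1) (θ' (π₀ f)) -
          coeff (Finsupp.single f 1) (θ' (π₀ u)) * coeff (Finsupp.single u 1) (θ' (π₀ f)) ≠ 0 →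
        constantCoeff U' ≠ 0 → E' ∈ originIdeal K ^ M → A₁.F = deletePthPowers p (U' ^ p * aeval θ' (c (k' + 1)).F) + E' →
        S₂.r = Finsupp.single la 1 + Finsupp.single mu 1 → (∀ e ∈ S₂.F.support, S₂.r ≤ e) →
        ordZero S₂.F = ((d + 2 : ℕ) : ℕ∞) → a ≠ 0 → resForm S₂ = C a * X f ^ d →
        (∀ e ∈ S₂.F.support, e f ≤ d - 1 → 2 ≤ e la ∧ 2 ≤ e mu) →
        f ∉ Φ.vars → constantCoeff Φ = 0 →
        (CentreBlowup.step p Finset.univ κ 0 S₂).F = deletePthPowers p (tsch f Φ A₁.F) →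
        ordZero (CentreBlowup.step p Finset.univ κ 0 S₂).F = ((d + 2 : ℕ) : ℕ∞) →
        IsIsolated p (CentreBlowup.step p Finset.univ κ 0 S₂).F →
        Module.finrank K (resVertex (CentreBlowup.step p Finset.univ κ 0 S₂)) = 3 →
        ∃ eu ef : ℕ, eu + ef = d - 2 ∧
          coeff ((CentreBlowup.step p Finset.univ κ 0 S₂).r +
            (Finsupp.single la 1 + Finsupp.single mu 1 + Finsupp.single u (eu + 1) + Finsupp.single f ef))
            (CentreBlowup.step p Finset.univ κ 0 S₂).F ≠ 0) : False := by
  -- two alive letters of weight one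
  have hB2 : ∀ k, k₀ ≤ k → (c k).r.support.card = 2 := fun k hk => by
    have hval : ∀ i ∈ (c k).r.support, (c k).r i = 1 := fun i hi => by
      have := (hwt k hk).1 i; have := Finsupp.mem_support_iff.mp hi; omega
    have h : (c k).r.degree = ∑ i ∈ (c k).r.support, (c k).r i := rfl
    rw [(hwt k hk).2, Finset.sum_congr rfl hval, Finset.sum_const, smul_eq_mul, mul_one] at h
    omega
  rcases light_pair_dichotomy p hc hw hfloor hB2 with ⟨k₁, -, hfree⟩ | ⟨k₁, hk₁, hborn⟩
  · -- a free tail is not isolated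
    obtain ⟨k, hk⟩ := FreeTailProof.noIsolatedFreeTailAt_self p K c j b k₁ hw hfree
    exact hk (hc k).1
  · exact cInf_no_chain_prime_of_chainFlag p hdp hd2 hc hw hr0 hfloor hshade he3 hk₁ hwt hborn
      fun k' hk' hk'1 => hQc k' (hk₁.trans hk') hk'1

/-- **THE C∞ CONFIGURATION IS IMPOSSIBLE FOR EVERY PRIME, MODULO Q-FLAG (corner form)** (module docstring). [OURS · CONDITIONAL]
[cite: CossartJannsenSaito2020, Thm. 3.14, Lemma 13.2] -/
theorem cInf_no_chain_prime_of_cornerFlag (p : ℕ) [hp : Fact p.Prime] [CharP K p] {d : ℕ} (hdp : d + 1 = p) (hd2 : 2 ≤ d)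
    {c : ℕ → State K} {j : ℕ → Fin 4} {b : ℕ → Fin 4 → K}
    (hc : ∀ k, IsIsolated p (c k).F ∧ Step0 p (c k) (c (k + 1))) (hw : FreeTail.IsWitnessedChain p c j b)
    (hr0 : ∀ e ∈ (c 0).F.support, (c 0).r ≤ e) (hfloor : ∀ k, ordZero (c k).F ≠ (p : ℕ)) {k₀ : ℕ}
    (hshade : ∀ k, k₀ ≤ k → (c k).shade = ((d : ℕ) : ℕ∞))
    (he3 : ∀ k, k₀ ≤ k → Module.finrank K (resVertex (c k)) = 3) {k₁ : ℕ} (hk₁ : k₀ ≤ k₁)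
    (hwt : ∀ k, k₀ ≤ k → (∀ i, (c k).r i ≤ 1) ∧ (c k).r.degree = 2)
    (hborn : ∀ k, k₁ ≤ k → ∀ i, 1 ≤ (c k).r i →
      ∃ t, k₀ ≤ t ∧ t < k ∧ j t = i ∧ ∀ m, t < m → m < k → j m ≠ i ∧ b m i = 0)
    (hQ : ∀ (la mu u f κ : Fin 4) (S₂ : State K) (a : K), la ≠ mu → la ≠ u → la ≠ f → mu ≠ u → mu ≠ f → u ≠ f →
      (κ = la ∨ κ = mu) → S₂.r = Finsupp.single la 1 + Finsupp.single mu 1 → (∀ e ∈ S₂.F.support, S₂.r ≤ e) →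
      ordZero S₂.F = ((d + 2 : ℕ) : ℕ∞) → a ≠ 0 → resForm S₂ = C a * X f ^ d →
      (∀ e ∈ S₂.F.support, e f ≤ d - 1 → 2 ≤ e la ∧ 2 ≤ e mu) →
      ordZero (CentreBlowup.step p Finset.univ κ 0 S₂).F = ((d + 2 : ℕ) : ℕ∞) →
      IsIsolated p (CentreBlowup.step p Finset.univ κ 0 S₂).F →
      Module.finrank K (resVertex (CentreBlowup.step p Finset.univ κ 0 S₂)) = 3 →
      ∃ eu ef : ℕ, eu + ef = d - 2 ∧
        coeff ((CentreBlowup.step p Finset.univ κ 0 S₂).r +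
          (Finsupp.single la 1 + Finsupp.single mu 1 + Finsupp.single u (eu + 1) + Finsupp.single f ef))
          (CentreBlowup.step p Finset.univ κ 0 S₂).F ≠ 0) : False :=
  SwapTransport.cInf_no_chain_of_entry_prime p hdp hd2 hc hw hr0 hfloor hshade he3 hwt
    (cInf_hE_of_chain_prime_of_cornerFlag p hdp hd2 hc hw hr0 hfloor hshade he3 hk₁ hwt hborn hQ)

/-- **NO LIGHT-PAIR POWER-CONE TAIL AT `(p, p − 1)`, MODULO Q-FLAG (corner form)** (module docstring): shade `≡ d = p − 1`,
`e_G ≡ 3`, light weights from `k₀` ⇒ `False`, given `hQ`. [OURS · CONDITIONAL] [cite: CossartJannsenSaito2020, Thm. 3.14] -/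
theorem no_light_pair_powerCone_tail_prime_of_cornerFlag (p : ℕ) [hp : Fact p.Prime] [CharP K p] {d : ℕ}
    (hdp : d + 1 = p) (hd2 : 2 ≤ d) {c : ℕ → State K} {j : ℕ → Fin 4} {b : ℕ → Fin 4 → K}
    (hc : ∀ k, IsIsolated p (c k).F ∧ Step0 p (c k) (c (k + 1))) (hw : FreeTail.IsWitnessedChain p c j b)
    (hr0 : ∀ e ∈ (c 0).F.support, (c 0).r ≤ e) (hfloor : ∀ k, ordZero (c k).F ≠ (p : ℕ)) {k₀ : ℕ}
    (hshade : ∀ k, k₀ ≤ k → (c k).shade = ((d : ℕ) : ℕ∞))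
    (he3 : ∀ k, k₀ ≤ k → Module.finrank K (resVertex (c k)) = 3)
    (hwt : ∀ k, k₀ ≤ k → (∀ i, (c k).r i ≤ 1) ∧ (c k).r.degree = 2)
    (hQ : ∀ (la mu u f κ : Fin 4) (S₂ : State K) (a : K), la ≠ mu → la ≠ u → la ≠ f → mu ≠ u → mu ≠ f → u ≠ f →
      (κ = la ∨ κ = mu) → S₂.r = Finsupp.single la 1 + Finsupp.single mu 1 → (∀ e ∈ S₂.F.support, S₂.r ≤ e) →
      ordZero S₂.F = ((d + 2 : ℕ) : ℕ∞) → a ≠ 0 → resForm S₂ = C a * X f ^ d →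
      (∀ e ∈ S₂.F.support, e f ≤ d - 1 → 2 ≤ e la ∧ 2 ≤ e mu) →
      ordZero (CentreBlowup.step p Finset.univ κ 0 S₂).F = ((d + 2 : ℕ) : ℕ∞) →
      IsIsolated p (CentreBlowup.step p Finset.univ κ 0 S₂).F →
      Module.finrank K (resVertex (CentreBlowup.step p Finset.univ κ 0 S₂)) = 3 →
      ∃ eu ef : ℕ, eu + ef = d - 2 ∧
        coeff ((CentreBlowup.step p Finset.univ κ 0 S₂).r +
          (Finsupp.single la 1 + Finsupp.single mu 1 + Finsupp.single u (eu + 1) + Finsupp.single f ef))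
          (CentreBlowup.step p Finset.univ κ 0 S₂).F ≠ 0) : False := by
  -- two alive letters of weight one
  have hB2 : ∀ k, k₀ ≤ k → (c k).r.support.card = 2 := fun k hk => by
    have hval : ∀ i ∈ (c k).r.support, (c k).r i = 1 := fun i hi => by
      have := (hwt k hk).1 i; have := Finsupp.mem_support_iff.mp hi; omega
    have h : (c k).r.degree = ∑ i ∈ (c k).r.support, (c k).r i := rfl
    rw [(hwt k hk).2, Finset.sum_congr rfl hval, Finset.sum_const, smul_eq_mul, mul_one] at h
    omega
  rcases light_pair_dichotomy p hc hw hfloor hB2 with ⟨k₁, -, hfree⟩ | ⟨k₁, hk₁, hborn⟩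
  · -- a free tail is not isolated
    obtain ⟨k, hk⟩ := FreeTailProof.noIsolatedFreeTailAt_self p K c j b k₁ hw hfree
    exact hk (hc k).1
  · exact cInf_no_chain_prime_of_cornerFlag p hdp hd2 hc hw hr0 hfloor hshade he3 hk₁ hwt hborn hQ

end ResCone

end Summit.ResolutionOfSingularities.ResolutionOfSingularities.Theorems.PIDim4

end
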